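import Mathlib
import Summits.Ventures.PercRepro2.RootCutTheorem
import Summits.Ventures.PercRepro2.TypedUntouched

/-!
# A root alone behind an unmarked cut vertex: the typed one-far-root rule (blind cell PercRepro2,
p3 g3, 2026-08-25; `proofs/P3-BRIDGE.md` §11.11)

CLASS (`CutFarRoot`): an unmarked cut vertex `c` of the support separates `VH ∋ o, a₂, a₃, b` from
`VL ∋ a₁`.  A copy's state is the root-side state with `c` as `a₁`, its `a₁`-coordinates gated by
the far bit `g = 1[c ↔ a₁]` (`st_eq_gluedR`); sorting the triples by the far PATTERN `S` of copies with
`g = 1`, **`typedCount F z τ K₃ = (e₁·P₁ + e₂·P₂ + e₃·P₃)·(inert)`** (`typedCount_eq_cutFarRoot`) with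
`e_k ≥ 0` the far count of a size-`k` pattern and `P_k` the root-side counts summed over the size-`k`
patterns: `P₀ = 0` (`KBsym_eq_zero_of_L`), `P₃` = the typed base of the smaller instance with `c`
renamed `a₁` (`count_P3_eq`), `P₁`, `P₂` = the typed bases of «`a₁` pendant at `c` by a type-1 / type-2
edge» (the typed (G4-u) coefficients); row 2′TRI on the class follows from the three gadgets
(`typedCount_nonneg_of_cutFarRoot`).  Own work; standard axioms. -/

namespace Summit.Ventures.PercRepro2

open UnionCluster

namespace CovForm

namespace RootBridge

open OneTyped TypedA3 Untouched TypedFactor Separated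

/-! ## The states -/
section States

/-- The state of a copy when `a₁` alone sits beyond `c`: the root-side state with `c` in the role
of `a₁`, its `a₁`-coordinates gated by the far bit `g = 1[c ↔ a₁]`. -/
def gluedR (h : St) (g : Bool) : St :=
  (h.q' && g, h.Lo && g, h.Ho, h.Lb && g, h.Hb, h.L3 && g, h.H3)

/-- The kernel on root-side states glued with a fixed far pattern `(sx, sy, sw)`. -/
def patR (sx sy sw : Bool) (hx hy hw : St) : ℤ :=
  KB (gluedR hx sx) (gluedR hy sy) (gluedR hw sw)

/-- The indicator of the exact far pattern `(sx, sy, sw)`. -/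
def exactR (sx sy sw gx gy gw : Bool) : ℤ :=
  (if gx = sx then 1 else 0) * (if gy = sy then 1 else 0) * (if gw = sw then 1 else 0)

/-- **The kernel on glued states, sorted by the far pattern**: exactly one pattern indicator is
`1`. -/
theorem KB_gluedR (hx hy hw : St) (gx gy gw : Bool) :
    KB (gluedR hx gx) (gluedR hy gy) (gluedR hw gw) =
      patR false false false hx hy hw * exactR false false false gx gy gw +
      patR true false false hx hy hw * exactR true false false gx gy gw +
      patR false true false hx hy hw * exactR false true false gx gy gw +
      patR false false true hx hy hw * exactR false false true gx gy gw +
      patR true true false hx hy hw * exactR true true false gx gy gw +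
      patR true false true hx hy hw * exactR true false true gx gy gw +
      patR false true true hx hy hw * exactR false true true gx gy gw +
      patR true true true hx hy hw * exactR true true true gx gy gw := by
  cases gx <;> cases gy <;> cases gw <;> simp [patR, exactR]

/-- The `a₁`-isolated pattern has a common `(q′, L)`-part, so its symmetrised kernel vanishes. -/
theorem patR_sym_zero (hx hy hw : St) :
    patR false false false hx hy hw + patR false false false hx hw hy +
      patR false false false hy hx hw + patR false false false hy hw hx +
      patR false false false hw hx hy + patR false false false hw hy hx = 0 := by
  have h := KBsym_eq_zero_of_L false false false false hx.Ho hx.Hb hx.H3 hy.Ho hy.Hb hy.H3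
    hw.Ho hw.Hb hw.H3
  unfold KBsym mkSt at h
  unfold patR gluedR
  simp only [Bool.and_false]
  exact h

end States

/-! ## The class, the states of the support and the rule -/
section Main

open Classical

variable {V : Type*} {E : Type*} [Fintype E] [DecidableEq E] {R : Type*} [Field R]
  [LinearOrder R] [IsStrictOrderedRing R]
variable (ends : E → Sym2 V) (o a₁ a₂ a₃ b c : V)

/-- **`a₁` alone behind an unmarked cut vertex `c`**: the support graph `z ∪ F` splits into a side
`VH ∋ o, a₂, a₃, b` and a side `VL ∋ a₁` meeting only in `c`, no typed edge inside both sides, `c`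
none of the five marks. -/
structure CutFarRoot (VL VH : Set V) (F : Finset E) (z : Config E) : Prop where
  split : ∀ e, zF F z e = true → e ∈ within ends VL ∨ e ∈ within ends VH
  cap : ∀ t, t ∈ VL → t ∈ VH → t = c
  noloop : ∀ e ∈ F, ¬ (e ∈ within ends VL ∧ e ∈ within ends VH)
  cL : c ∈ VL
  cH : c ∈ VH
  oH : o ∈ VH
  a2H : a₂ ∈ VH
  a3H : a₃ ∈ VH
  bH : b ∈ VH
  a1L : a₁ ∈ VL
  oc : o ≠ c
  a2c : a₂ ≠ c
  a3c : a₃ ≠ c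
  bc : b ≠ c
  a1c : a₁ ≠ c

omit [Fintype E] [LinearOrder R] [IsStrictOrderedRing R] in
/-- A configuration below `z ∪ F` has its open edges within a side. -/
lemma CutFarRoot.split_of_le {VL VH : Set V} {F : Finset E} {z : Config E}
    (h : CutFarRoot ends o a₁ a₂ a₃ b c VL VH F z) {x : Config E} (hx : x ≤ zF F z) :
    ∀ e, x e = true → e ∈ within ends VL ∨ e ∈ within ends VH := fun e he =>
  h.split e (by have := hx e; rw [he] at this; exact Bool.eq_true_of_true_le this)

omit [Fintype E] [LinearOrder R] [IsStrictOrderedRing R] in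
/-- **The state of a copy of the support**: the root-side state of the instance with `c` renamed
`a₁`, gated by the far bit `1[c ↔ a₁]`. -/
theorem st_eq_gluedR {VL VH : Set V} {F : Finset E} {z : Config E}
    (h : CutFarRoot ends o a₁ a₂ a₃ b c VL VH F z) {x : Config E} (hx : ∀ e, e ∉ F → x e = z e) :
    st ends o a₁ a₂ a₃ b x =
      gluedR (st ends o c a₂ a₃ b (withinRestr ends VH x))
        (decide (Conn ends (withinRestr ends VL x) a₁ c)) := by
  have hsp := CutFarRoot.split_of_le ends o a₁ a₂ a₃ b c h (le_zF hx)
  have hsp' : ∀ e, x e = true → e ∈ within ends VH ∨ e ∈ within ends VL := fun e he =>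
    (hsp e he).symm
  have hcap' : ∀ t, t ∈ VH → t ∈ VL → t = c := fun t h1 h2 => h.cap t h2 h1
  unfold st gluedR St.q' St.Lo St.Ho St.Lb St.Hb St.L3 St.H3
  have e1 : Conn ends x a₂ a₁ ↔
      Conn ends (withinRestr ends VH x) a₂ c ∧ Conn ends (withinRestr ends VL x) a₁ c := by
    rw [conn_cross ends hsp' hcap' ⟨h.cH, h.cL⟩ h.a2H h.a1L h.a1c]
    exact and_congr Iff.rfl ⟨conn_symm, conn_symm⟩
  have e2 : Conn ends x a₁ o ↔
      Conn ends (withinRestr ends VH x) c o ∧ Conn ends (withinRestr ends VL x) a₁ c := by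
    rw [conn_cross ends hsp h.cap ⟨h.cL, h.cH⟩ h.a1L h.oH h.oc]
    exact and_comm
  have e3 := conn_side ends hsp' hcap' h.a2H h.oH
  have e4 : Conn ends x a₁ b ↔
      Conn ends (withinRestr ends VH x) c b ∧ Conn ends (withinRestr ends VL x) a₁ c := by
    rw [conn_cross ends hsp h.cap ⟨h.cL, h.cH⟩ h.a1L h.bH h.bc]
    exact and_comm
  have e5 := conn_side ends hsp' hcap' h.a2H h.bH
  have e6 : Conn ends x a₁ a₃ ↔
      Conn ends (withinRestr ends VH x) c a₃ ∧ Conn ends (withinRestr ends VL x) a₁ c := by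
    rw [conn_cross ends hsp h.cap ⟨h.cL, h.cH⟩ h.a1L h.a3H h.a3c]
    exact and_comm
  have e7 := conn_side ends hsp' hcap' h.a2H h.a3H
  rw [decide_eq_decide.mpr e1, decide_eq_decide.mpr e2, decide_eq_decide.mpr e3,
    decide_eq_decide.mpr e4, decide_eq_decide.mpr e5, decide_eq_decide.mpr e6,
    decide_eq_decide.mpr e7]
  · simp only [Bool.decide_and]
  all_goals infer_instance

/-- The root-side kernel of a fixed far pattern, read on the root side. -/
noncomputable def hKRt (VH : Set V) (sx sy sw : Bool) : Config E → Config E → Config E → R :=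
  fun x y w => ((patR sx sy sw (st ends o c a₂ a₃ b (withinRestr ends VH x))
    (st ends o c a₂ a₃ b (withinRestr ends VH y)) (st ends o c a₂ a₃ b (withinRestr ends VH w)) : ℤ) : R)

/-- The far-side kernel of the exact pattern `(sx, sy, sw)`. -/
noncomputable def lKRt (VL : Set V) (sx sy sw : Bool) : Config E → Config E → Config E → R :=
  fun x y w => ((exactR sx sy sw (decide (Conn ends (withinRestr ends VL x) a₁ c))
    (decide (Conn ends (withinRestr ends VL y) a₁ c))
    (decide (Conn ends (withinRestr ends VL w) a₁ c)) : ℤ) : R)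

omit [Fintype E] [LinearOrder R] [IsStrictOrderedRing R] in
/-- **`K₃` on the support** when `a₁` alone sits beyond `c`: the eight-pattern form. -/
theorem K3_eq_cutFarRoot {VL VH : Set V} {F : Finset E} {z : Config E}
    (h : CutFarRoot ends o a₁ a₂ a₃ b c VL VH F z) {x y w : Config E}
    (hx : ∀ e, e ∉ F → x e = z e) (hy : ∀ e, e ∉ F → y e = z e) (hw : ∀ e, e ∉ F → w e = z e) :
    (K3 ends o a₁ a₂ a₃ b x y w : R) =
      lKRt ends a₁ c VL false false false (restr (sideF ends VL F) z x) (restr (sideF ends VL F) z y)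
          (restr (sideF ends VL F) z w) * hKRt ends o a₂ a₃ b c VH false false false
          (restr (sideF ends VH F) z x) (restr (sideF ends VH F) z y) (restr (sideF ends VH F) z w) +
      lKRt ends a₁ c VL true false false (restr (sideF ends VL F) z x) (restr (sideF ends VL F) z y)
          (restr (sideF ends VL F) z w) * hKRt ends o a₂ a₃ b c VH true false false
          (restr (sideF ends VH F) z x) (restr (sideF ends VH F) z y) (restr (sideF ends VH F) z w) +
      lKRt ends a₁ c VL false true false (restr (sideF ends VL F) z x) (restr (sideF ends VL F) z y)
          (restr (sideF ends VL F) z w) * hKRt ends o a₂ a₃ b c VH false true false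
          (restr (sideF ends VH F) z x) (restr (sideF ends VH F) z y) (restr (sideF ends VH F) z w) +
      lKRt ends a₁ c VL false false true (restr (sideF ends VL F) z x) (restr (sideF ends VL F) z y)
          (restr (sideF ends VL F) z w) * hKRt ends o a₂ a₃ b c VH false false true
          (restr (sideF ends VH F) z x) (restr (sideF ends VH F) z y) (restr (sideF ends VH F) z w) +
      lKRt ends a₁ c VL true true false (restr (sideF ends VL F) z x) (restr (sideF ends VL F) z y)
          (restr (sideF ends VL F) z w) * hKRt ends o a₂ a₃ b c VH true true false
          (restr (sideF ends VH F) z x) (restr (sideF ends VH F) z y) (restr (sideF ends VH F) z w) +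
      lKRt ends a₁ c VL true false true (restr (sideF ends VL F) z x) (restr (sideF ends VL F) z y)
          (restr (sideF ends VL F) z w) * hKRt ends o a₂ a₃ b c VH true false true
          (restr (sideF ends VH F) z x) (restr (sideF ends VH F) z y) (restr (sideF ends VH F) z w) +
      lKRt ends a₁ c VL false true true (restr (sideF ends VL F) z x) (restr (sideF ends VL F) z y)
          (restr (sideF ends VL F) z w) * hKRt ends o a₂ a₃ b c VH false true true
          (restr (sideF ends VH F) z x) (restr (sideF ends VH F) z y) (restr (sideF ends VH F) z w) +
      lKRt ends a₁ c VL true true true (restr (sideF ends VL F) z x) (restr (sideF ends VL F) z y)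
          (restr (sideF ends VL F) z w) * hKRt ends o a₂ a₃ b c VH true true true
          (restr (sideF ends VH F) z x) (restr (sideF ends VH F) z y) (restr (sideF ends VH F) z w) := by
  rw [K3_eq_KB, st_eq_gluedR ends o a₁ a₂ a₃ b c h hx, st_eq_gluedR ends o a₁ a₂ a₃ b c h hy,
    st_eq_gluedR ends o a₁ a₂ a₃ b c h hw, KB_gluedR]
  unfold hKRt lKRt
  rw [withinRestr_restr_eq ends VH hx, withinRestr_restr_eq ends VH hy,
    withinRestr_restr_eq ends VH hw, withinRestr_restr_eq ends VL hx,
    withinRestr_restr_eq ends VL hy, withinRestr_restr_eq ends VL hw]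
  push_cast
  ring

omit [Fintype E] [DecidableEq E] [LinearOrder R] [IsStrictOrderedRing R] in
/-- Gluing with `g = true` is the identity. -/
lemma gluedR_true (h : St) : gluedR h true = h := by
  rcases h with ⟨q, lo, ho, lb, hb, l3, h3⟩
  simp [gluedR, St.q', St.Lo, St.Ho, St.Lb, St.Hb, St.L3, St.H3]

omit [Fintype E] [LinearOrder R] [IsStrictOrderedRing R] in
/-- The state of the root-side instance only sees the root side. -/
lemma st_sideR {VL VH : Set V} {F : Finset E} {z : Config E}
    (h : CutFarRoot ends o a₁ a₂ a₃ b c VL VH F z) {x : Config E} (hx : x ≤ zF F z) :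
    st ends o c a₂ a₃ b x = st ends o c a₂ a₃ b (withinRestr ends VH x) := by
  have hsp := CutFarRoot.split_of_le ends o a₁ a₂ a₃ b c h hx
  have hsp' : ∀ e, x e = true → e ∈ within ends VH ∨ e ∈ within ends VL := fun e he =>
    (hsp e he).symm
  have hcap' : ∀ t, t ∈ VH → t ∈ VL → t = c := fun t h1 h2 => h.cap t h2 h1
  unfold st
  rw [decide_eq_decide.mpr (conn_side ends hsp' hcap' h.a2H h.cH),
    decide_eq_decide.mpr (conn_side ends hsp' hcap' h.cH h.oH),
    decide_eq_decide.mpr (conn_side ends hsp' hcap' h.a2H h.oH),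
    decide_eq_decide.mpr (conn_side ends hsp' hcap' h.cH h.bH),
    decide_eq_decide.mpr (conn_side ends hsp' hcap' h.a2H h.bH),
    decide_eq_decide.mpr (conn_side ends hsp' hcap' h.cH h.a3H),
    decide_eq_decide.mpr (conn_side ends hsp' hcap' h.a2H h.a3H)]

omit [LinearOrder R] [IsStrictOrderedRing R] in
/-- **`P₃`**: the all-glued root-side count is the typed base of the instance with `c` renamed
`a₁`. -/
lemma count_P3_eq {VL VH : Set V} {F : Finset E} {z : Config E} (τ : E → ℕ)
    (h : CutFarRoot ends o a₁ a₂ a₃ b c VL VH F z) :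
    typedCount (sideF ends VH F) z τ
        (hKRt ends o a₂ a₃ b c VH true true true : Config E → Config E → Config E → R) =
      typedCount (sideF ends VH F) z τ (K3 ends o c a₂ a₃ b : Config E → Config E → Config E → R) := by
  refine typedCount_congr_on_support _ z τ fun x y w hc _ => ?_
  have hBF : sideF ends VH F ⊆ F := Finset.filter_subset _ _
  have hle : ∀ v : Config E, (∀ e, e ∉ sideF ends VH F → v e = z e) → v ≤ zF F z := fun v hv =>
    le_zF fun e he => hv e fun hB => he (hBF hB)
  unfold hKRt patR
  rw [gluedR_true, gluedR_true, gluedR_true, K3_eq_KB,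
    st_sideR ends o a₁ a₂ a₃ b c h (hle x fun e he => (hc e he).1),
    st_sideR ends o a₁ a₂ a₃ b c h (hle y fun e he => (hc e he).2.1),
    st_sideR ends o a₁ a₂ a₃ b c h (hle w fun e he => (hc e he).2.2)]

/-- **`P₀ = 0`**: the `a₁`-isolated root-side count vanishes (`KBsym_eq_zero_of_L`). -/
lemma count_P0_eq_zero (VH : Set V) (B : Finset E) (z : Config E) (τ : E → ℕ)
    (hτ : ∀ e ∈ B, τ e = 1 ∨ τ e = 2) :
    typedCount B z τ (hKRt ends o a₂ a₃ b c VH false false false : Config E → Config E → Config E → R) = 0 := by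
  have h6 := six_mul_typedCount B z τ hτ
    (hKRt ends o a₂ a₃ b c VH false false false : Config E → Config E → Config E → R)
  have hzero : typedCount B z τ (fun x y w =>
      (hKRt ends o a₂ a₃ b c VH false false false x y w : R) +
        hKRt ends o a₂ a₃ b c VH false false false x w y +
        hKRt ends o a₂ a₃ b c VH false false false y x w +
        hKRt ends o a₂ a₃ b c VH false false false y w x +
        hKRt ends o a₂ a₃ b c VH false false false w x y +
        hKRt ends o a₂ a₃ b c VH false false false w y x) =
      typedCount B z τ (fun _ _ _ => (0 : R)) := by
    refine typedCount_congr' _ _ _ _ _ fun x y w => ?_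
    have h0 := patR_sym_zero (st ends o c a₂ a₃ b (withinRestr ends VH x))
      (st ends o c a₂ a₃ b (withinRestr ends VH y)) (st ends o c a₂ a₃ b (withinRestr ends VH w))
    unfold hKRt
    have h0' := congrArg (fun n : ℤ => (n : R)) h0
    push_cast at h0' ⊢
    linear_combination h0'
  have : (6 : R) * typedCount B z τ
      (hKRt ends o a₂ a₃ b c VH false false false : Config E → Config E → Config E → R) = 0 := by
    rw [h6, hzero, typedCount_zero_kernel]
  exact (mul_eq_zero.1 this).resolve_left (by norm_num)

omit [LinearOrder R] [IsStrictOrderedRing R] in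
/-- The far-side exact-pattern counts depend on the pattern's size only (copy symmetry). -/
lemma count_lKRt_symm (VL : Set V) (A : Finset E) (z : Config E) (τ : E → ℕ)
    (hτ : ∀ e ∈ A, τ e = 1 ∨ τ e = 2) :
    typedCount A z τ (lKRt ends a₁ c VL true false false : Config E → Config E → Config E → R) =
        typedCount A z τ (lKRt ends a₁ c VL false false true) ∧
      typedCount A z τ (lKRt ends a₁ c VL false true false : Config E → Config E → Config E → R) =
        typedCount A z τ (lKRt ends a₁ c VL false false true) ∧
      typedCount A z τ (lKRt ends a₁ c VL true true false : Config E → Config E → Config E → R) =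
        typedCount A z τ (lKRt ends a₁ c VL false true true) ∧
      typedCount A z τ (lKRt ends a₁ c VL true false true : Config E → Config E → Config E → R) =
        typedCount A z τ (lKRt ends a₁ c VL false true true) := by
  refine ⟨?_, ?_, ?_, ?_⟩
  · rw [← typedCount_swap13 A z τ hτ (lKRt ends a₁ c VL false false true)]
    exact typedCount_congr' _ _ _ _ _ fun x y w => by unfold lKRt exactR; push_cast; ring
  · rw [← typedCount_swap23 A z τ hτ (lKRt ends a₁ c VL false false true)]
    exact typedCount_congr' _ _ _ _ _ fun x y w => by unfold lKRt exactR; push_cast; ring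
  · rw [← typedCount_swap13 A z τ hτ (lKRt ends a₁ c VL false true true)]
    exact typedCount_congr' _ _ _ _ _ fun x y w => by unfold lKRt exactR; push_cast; ring
  · rw [← typedCount_swap12 A z τ (lKRt ends a₁ c VL false true true)]
    exact typedCount_congr' _ _ _ _ _ fun x y w => by unfold lKRt exactR; push_cast; ring

/-- **THE TYPED ONE-FAR-ROOT RULE**: sorting by the far pattern,
`typedCount F z τ K₃ = (e₁ · P₁ + e₂ · P₂ + e₃ · P₃) · (inert count)`, `e_k` the far count of a
pattern of size `k`, `P_k` the sum of the root-side counts over the patterns of size `k`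
(`P₀ = 0`). -/
theorem typedCount_eq_cutFarRoot {VL VH : Set V} (F : Finset E) (z : Config E) (τ : E → ℕ)
    (hτ : ∀ e ∈ F, τ e = 1 ∨ τ e = 2) (h : CutFarRoot ends o a₁ a₂ a₃ b c VL VH F z) :
    typedCount F z τ (K3 ends o a₁ a₂ a₃ b : Config E → Config E → Config E → R) =
      (typedCount (sideF ends VL F) z τ (lKRt ends a₁ c VL false false true) *
          (typedCount (sideF ends VH F) z τ (hKRt ends o a₂ a₃ b c VH true false false) +
            typedCount (sideF ends VH F) z τ (hKRt ends o a₂ a₃ b c VH false true false) +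
            typedCount (sideF ends VH F) z τ (hKRt ends o a₂ a₃ b c VH false false true)) +
        typedCount (sideF ends VL F) z τ (lKRt ends a₁ c VL false true true) *
          (typedCount (sideF ends VH F) z τ (hKRt ends o a₂ a₃ b c VH true true false) +
            typedCount (sideF ends VH F) z τ (hKRt ends o a₂ a₃ b c VH true false true) +
            typedCount (sideF ends VH F) z τ (hKRt ends o a₂ a₃ b c VH false true true)) +
        typedCount (sideF ends VL F) z τ (lKRt ends a₁ c VL true true true) *
          typedCount (sideF ends VH F) z τ (K3 ends o c a₂ a₃ b)) *
        typedCount (F \ (sideF ends VL F ∪ sideF ends VH F)) z τ (fun _ _ _ => (1 : R)) := by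
  set A := sideF ends VL F with hA
  set B := sideF ends VH F with hB
  set C := F \ (A ∪ B) with hC
  have hAF : A ⊆ F := Finset.filter_subset _ _
  have hBF : B ⊆ F := Finset.filter_subset _ _
  have hAB : Disjoint A B := by
    rw [Finset.disjoint_left]
    intro e heA heB
    simp only [hA, hB, sideF, Finset.mem_filter] at heA heB
    exact h.noloop e heA.1 ⟨heA.2, heB.2⟩
  have hABF : A ∪ B ⊆ F := Finset.union_subset hAF hBF
  have hAC : Disjoint A C := Finset.disjoint_of_subset_left Finset.subset_union_left Finset.disjoint_sdiff
  have hBC : Disjoint B C := Finset.disjoint_of_subset_left Finset.subset_union_right Finset.disjoint_sdiff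
  have hF : A ∪ B ∪ C = F := Finset.union_sdiff_of_subset hABF
  have hτA : ∀ e ∈ A, τ e = 1 ∨ τ e = 2 := fun e he => hτ e (hAF he)
  have hτB : ∀ e ∈ B, τ e = 1 ∨ τ e = 2 := fun e he => hτ e (hBF he)
  have hker : typedCount F z τ (K3 ends o a₁ a₂ a₃ b : Config E → Config E → Config E → R) =
      typedCount F z τ (fun x y w =>
        lKRt ends a₁ c VL false false false (restr A z x) (restr A z y) (restr A z w) *
            hKRt ends o a₂ a₃ b c VH false false false (restr B z x) (restr B z y) (restr B z w) +
          lKRt ends a₁ c VL true false false (restr A z x) (restr A z y) (restr A z w) *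
            hKRt ends o a₂ a₃ b c VH true false false (restr B z x) (restr B z y) (restr B z w) +
          lKRt ends a₁ c VL false true false (restr A z x) (restr A z y) (restr A z w) *
            hKRt ends o a₂ a₃ b c VH false true false (restr B z x) (restr B z y) (restr B z w) +
          lKRt ends a₁ c VL false false true (restr A z x) (restr A z y) (restr A z w) *
            hKRt ends o a₂ a₃ b c VH false false true (restr B z x) (restr B z y) (restr B z w) +
          lKRt ends a₁ c VL true true false (restr A z x) (restr A z y) (restr A z w) *
            hKRt ends o a₂ a₃ b c VH true true false (restr B z x) (restr B z y) (restr B z w) +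
          lKRt ends a₁ c VL true false true (restr A z x) (restr A z y) (restr A z w) *
            hKRt ends o a₂ a₃ b c VH true false true (restr B z x) (restr B z y) (restr B z w) +
          lKRt ends a₁ c VL false true true (restr A z x) (restr A z y) (restr A z w) *
            hKRt ends o a₂ a₃ b c VH false true true (restr B z x) (restr B z y) (restr B z w) +
          lKRt ends a₁ c VL true true true (restr A z x) (restr A z y) (restr A z w) *
            hKRt ends o a₂ a₃ b c VH true true true (restr B z x) (restr B z y) (restr B z w)) := by
    refine typedCount_congr_on_support F z τ fun x y w hc _ => ?_
    exact K3_eq_cutFarRoot ends o a₁ a₂ a₃ b c h (fun e he => (hc e he).1)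
      (fun e he => (hc e he).2.1) (fun e he => (hc e he).2.2)
  rw [hker, typedCount_add', typedCount_add', typedCount_add', typedCount_add',
    typedCount_add', typedCount_add', typedCount_add']
  have hm : ∀ sx sy sw : Bool, typedCount (A ∪ B ∪ C) z τ (fun x y w =>
      lKRt ends a₁ c VL sx sy sw (restr A z x) (restr A z y) (restr A z w) *
        hKRt ends o a₂ a₃ b c VH sx sy sw (restr B z x) (restr B z y) (restr B z w)) =
      typedCount A z τ (lKRt ends a₁ c VL sx sy sw) *
        typedCount B z τ (hKRt ends o a₂ a₃ b c VH sx sy sw) *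
        typedCount C z τ (fun _ _ _ => (1 : R)) := fun sx sy sw =>
    typedCount_mul_three A B C hAB hAC hBC z τ (lKRt ends a₁ c VL sx sy sw)
      (hKRt ends o a₂ a₃ b c VH sx sy sw : Config E → Config E → Config E → R)
  rw [hF] at hm
  rw [hm false false false, hm true false false, hm false true false, hm false false true,
    hm true true false, hm true false true, hm false true true, hm true true true]
  obtain ⟨s1, s2, s3, s4⟩ := count_lKRt_symm (R := R) ends a₁ c VL A z τ hτA
  rw [s1, s2, s3, s4, count_P0_eq_zero (R := R) ends o a₂ a₃ b c VH B z τ hτB,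
    count_P3_eq (R := R) ends o a₁ a₂ a₃ b c τ h]
  rw [← hB]
  ring

/-- **Row 2′TRI when a root sits alone behind an unmarked cut vertex** follows from row 2′TRI on
the three gadgets: the root pendant at `c` by a type-1 edge (`P₁`), by a type-2 edge (`P₂`), and
the smaller instance with `c` renamed `a₁` (`P₃`). -/
theorem typedCount_nonneg_of_cutFarRoot {VL VH : Set V} (F : Finset E) (z : Config E) (τ : E → ℕ)
    (hτ : ∀ e ∈ F, τ e = 1 ∨ τ e = 2) (h : CutFarRoot ends o a₁ a₂ a₃ b c VL VH F z)
    (h1 : 0 ≤ typedCount (sideF ends VH F) z τ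
        (hKRt ends o a₂ a₃ b c VH true false false : Config E → Config E → Config E → R) +
      typedCount (sideF ends VH F) z τ (hKRt ends o a₂ a₃ b c VH false true false) +
      typedCount (sideF ends VH F) z τ (hKRt ends o a₂ a₃ b c VH false false true))
    (h2 : 0 ≤ typedCount (sideF ends VH F) z τ
        (hKRt ends o a₂ a₃ b c VH true true false : Config E → Config E → Config E → R) +
      typedCount (sideF ends VH F) z τ (hKRt ends o a₂ a₃ b c VH true false true) +
      typedCount (sideF ends VH F) z τ (hKRt ends o a₂ a₃ b c VH false true true))
    (h3 : 0 ≤ typedCount (sideF ends VH F) z τ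
        (K3 ends o c a₂ a₃ b : Config E → Config E → Config E → R)) :
    0 ≤ typedCount F z τ (K3 ends o a₁ a₂ a₃ b : Config E → Config E → Config E → R) := by
  rw [typedCount_eq_cutFarRoot ends o a₁ a₂ a₃ b c F z τ hτ h]
  have hL : ∀ sx sy sw : Bool, (0 : R) ≤ typedCount (sideF ends VL F) z τ
      (lKRt ends a₁ c VL sx sy sw) := fun sx sy sw => by
    refine typedCount_nonneg_of_nonneg _ _ _ fun x y w => ?_
    unfold lKRt exactR
    push_cast
    refine mul_nonneg (mul_nonneg ?_ ?_) ?_ <;> split_ifs <;> simp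
  have hI : (0 : R) ≤ typedCount (F \ (sideF ends VL F ∪ sideF ends VH F)) z τ
      (fun _ _ _ => (1 : R)) :=
    typedCount_nonneg_of_nonneg _ _ _ fun _ _ _ => zero_le_one
  refine mul_nonneg ?_ hI
  exact add_nonneg (add_nonneg (mul_nonneg (hL false false true) h1)
    (mul_nonneg (hL false true true) h2)) (mul_nonneg (hL true true true) h3)

end Main

end RootBridge

end CovForm

end Summit.Ventures.PercRepro2
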